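import Literature.RingTheory.HilbertSamuel.ProjDirectrixLifts
import Mathlib.LinearAlgebra.FiniteDimensional.Lemmas
import HarnessLib

/-!
# «`ξ ∈ ℙ(Dir(𝒪))`» read on an ARBITRARY generating family of `𝔪`: the symbols of any generators span the
# degree-one forms, and `ProjDirLiftsInto φ` is the condition «`φ(Σ λ_l c_l) ∈ (𝔪B)·𝔪_B` whenever the symbol of
# `Σ λ_l c_l` lies in the directrix space» (CJS 2020, Def. 2.18 / Def. 6.34 (i), p. 103)

Topic: `Literature/RingTheory/HilbertSamuel`. Continuation of `ProjDirectrixLifts.lean`. Let `A` be a noetherian local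
ring with residue field `k`, `x_1, …, x_e` a MINIMAL system of generators of `𝔪` (`e = emb.dim A`), `J = J_x ⊆ k[X]` the
tangent cone ideal and `𝒯 = 𝒯(J) ⊆ S_1 = ⊕ k X_i` its directrix space (CJS Lemma 2.7 / Def. 2.18). Let
`c_1, …, c_r` be ANY system of generators of `𝔪` with chosen expansions `c_l = Σ_i a_{li} x_i`, and write
`s_l = Σ_i ā_{li} X_i ∈ S_1` for the symbol of `c_l`. PROVED here:

* `X_eq_sum_smul_symbol` / `exists_eq_sum_smul_symbol` — **the symbols `s_l` span `S_1`**: writing `x_i = Σ_l b_{il} c_l`,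
  `X_i = Σ_l b̄_{il} s_l` (the relation `Σ_j ((ba)_{ij} − δ_{ij}) x_j = 0` has coefficients in `𝔪` by the minimality of
  `x`, `mem_maximalIdeal_of_sum_mul_mem_sq`), hence every linear form is a `k`-combination of the `s_l`;
* `ProjDirLiftsInto.map_sum_mul_mem` — if `ProjDirLiftsInto φ x` («`ξ ∈ ℙ(Dir)`» read through `φ : A → B`) and the
  symbol `Σ_l λ̄_l s_l` of a combination `Σ_l λ_l c_l` lies in `𝒯`, then `φ(Σ_l λ_l c_l) ∈ (𝔪B)·𝔪_B` (that combination IS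
  a lift of its symbol: `Σ_l λ_l c_l = Σ_i (Σ_l λ_l a_{li}) x_i`);
* `projDirLiftsInto_of_forall_symbol_mem` — conversely (for `φ(𝔪) ⊆ 𝔪_B`), if for every coefficient vector `μ ∈ k^r`
  some lift `λ` of `μ` satisfies «symbol in `𝒯` ⇒ `φ(Σ_l λ_l c_l) ∈ (𝔪B)·𝔪_B`», then `ProjDirLiftsInto φ x` (every
  `L ∈ 𝒯` is `Σ μ_l s_l`, the combination is a lift of `L`, and lifts are interchangeable,
  `map_lift_mem_iff_of_lifts`). The «some lift of each `μ`» form is what the blow-up charts supply: there the `λ_l`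
  come from SECTIONS `Γ(X, U) → 𝒪_{X,x}`, whose residues exhaust `k(x)` because `x` is a closed point.

This is the algebra behind reading `ℙ(Dir_x(X)) ⊂ Bℓ_x(X)` on the chart `Spec Γ(U)[𝔭_x/c_j]` at a generator `c_j` of
`𝔭_x`: there `φ(Σ λ_l c_l) = φ(c_j)·(Σ λ_l c_l/c_j)`, so `ℙ(Dir)` is cut out by `𝔭_x` and the regular functions
`Σ λ_l (c_l/c_j)` with symbol in `𝒯` (`CossartJannsenSaito2020/ProjDirClosed.lean`). Everything here is PROVED.

## References

* V. Cossart, U. Jannsen, S. Saito, *Desingularization: Invariants and Strategy*, LNM 2270 (2020), Lemma 2.7,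
  Def. 2.18, Def. 2.26, Def. 6.34 (i), p. 103. [CossartJannsenSaito2020]
-/

noncomputable section

open IsLocalRing MvPolynomial Module
open Literature.AlgebraicGeometry.Resolution Literature.RingTheory.MvPolynomial

namespace Literature.RingTheory.HilbertSamuel

universe u v w

/-! ## Linear forms: coefficients and sums -/

section LinearForms

variable {k : Type v} [Field k] {e : ℕ}

/-- The `X_i`-coefficient of `Σ v_j X_j` is `v_i`. [folklore] -/
private theorem coeff_single_one_linForm' (v : Fin e → k) (i : Fin e) :
    MvPolynomial.coeff (Finsupp.single i 1) (linForm v) = v i := by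
  classical
  rw [linForm_apply, MvPolynomial.coeff_sum]
  simp_rw [MvPolynomial.coeff_smul, MvPolynomial.coeff_X, smul_eq_mul]
  rw [Finset.sum_eq_single i]
  · simp
  · intro j _ hj
    rw [if_neg, mul_zero]
    exact fun h => hj (Finsupp.single_left_injective one_ne_zero h)
  · exact fun h => absurd (Finset.mem_univ i) h

/-- `linForm` is `k`-linear in the coefficient vector (sum form). [folklore] -/
private theorem linForm_sum_smul' {ι : Type*} (s : Finset ι) (r : ι → k) (v : ι → Fin e → k) :
    linForm (fun i => ∑ l ∈ s, r l * v l i) = ∑ l ∈ s, r l • linForm (v l) := by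
  have h : (fun i => ∑ l ∈ s, r l * v l i) = ∑ l ∈ s, r l • v l := by
    funext i
    simp [Finset.sum_apply, Pi.smul_apply, smul_eq_mul]
  rw [h, map_sum]
  exact Finset.sum_congr rfl fun l _ => by rw [map_smul]

/-- A form of degree `1` is the linear form of its `X_i`-coefficients. [folklore] -/
private theorem eq_linForm_coeff' {L : MvPolynomial (Fin e) k} (hL : L ∈ homogeneousSubmodule (Fin e) k 1) :
    L = linForm fun i => MvPolynomial.coeff (Finsupp.single i 1) L := by
  have hL' : L ∈ LinearMap.range (linForm (K := k) (n := e)) := by rwa [range_linForm]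
  obtain ⟨v, rfl⟩ := hL'
  congr 1
  funext i
  rw [coeff_single_one_linForm']

end LinearForms

/-! ## The symbols of a generating family of `𝔪` span the degree-one forms -/

section Symbols

variable {A : Type u} [CommRing A] [IsLocalRing A] [IsNoetherianRing A] {e : ℕ} {x : Fin e → A}
  (hx : Ideal.span (Set.range x) = maximalIdeal A) (he : (maximalIdeal A).spanFinrank = e)
  {r : ℕ} {c : Fin r → A} (hc : Ideal.span (Set.range c) = maximalIdeal A)
  (a : Fin r → Fin e → A) (hca : ∀ l, c l = ∑ i, a l i * x i)

include hx he hc hca in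
/-- **`X_i = Σ_l b̄_{il} s_l`**: each variable of `S_1 = 𝔪/𝔪²` is a `k`-combination of the symbols
`s_l = Σ_i ā_{li} X_i` of ANY generators `c_l = Σ_i a_{li} x_i` of `𝔪` (with `x` minimal). Writing `x_i = Σ_l b_{il} c_l`,
the relation `Σ_j ((ba)_{ij} − δ_{ij}) x_j = 0 ∈ 𝔪²` forces `(ba)_{ij} ≡ δ_{ij}` modulo `𝔪`
(`mem_maximalIdeal_of_sum_mul_mem_sq`). [cite: CossartJannsenSaito2020, Lemma 2.7, Def. 2.18] -/
theorem X_mem_span_symbol (i : Fin e) :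
    (X i : MvPolynomial (Fin e) (ResidueField A)) ∈
      Submodule.span (ResidueField A) (Set.range fun l => linForm fun j => residue A (a l j)) := by
  classical
  -- `x_i = Σ_l b_l c_l`
  obtain ⟨b, hb⟩ : ∃ b : Fin r → A, ∑ l, b l * c l = x i :=
    Ideal.mem_span_range_iff_exists_fun.mp (by rw [hc, ← hx]; exact Ideal.subset_span ⟨i, rfl⟩)
  -- the matrix relation
  have hrel : ∑ j, ((∑ l, b l * a l j) - if j = i then 1 else 0) * x j ∈ maximalIdeal A ^ 2 := by
    have h0 : ∑ j, ((∑ l, b l * a l j) - if j = i then 1 else 0) * x j = 0 := by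
      simp only [sub_mul, Finset.sum_sub_distrib]
      rw [sub_eq_zero]
      have h1 : ∑ j, (∑ l, b l * a l j) * x j = x i := by
        rw [← hb]
        simp_rw [Finset.sum_mul, mul_assoc]
        rw [Finset.sum_comm]
        exact Finset.sum_congr rfl fun l _ => by rw [← Finset.mul_sum, ← hca l]
      rw [h1, Finset.sum_eq_single i (fun j _ hj => by rw [if_neg hj, zero_mul])
        (fun h => absurd (Finset.mem_univ i) h), if_pos rfl, one_mul]
    rw [h0]
    exact zero_mem _
  have hcoef : ∀ j, residue A (∑ l, b l * a l j) = if j = i then 1 else 0 := by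
    intro j
    have h := mem_maximalIdeal_of_sum_mul_mem_sq hx he hrel j
    rw [← residue_eq_zero_iff, map_sub, sub_eq_zero] at h
    rw [h]
    split_ifs <;> simp
  -- `X_i = Σ_l b̄_l s_l`
  have hXi : (X i : MvPolynomial (Fin e) (ResidueField A)) =
      ∑ l, residue A (b l) • linForm (fun j => residue A (a l j)) := by
    rw [← linForm_sum_smul' Finset.univ (fun l => residue A (b l)) (fun l j => residue A (a l j)),
      ← linForm_single i]
    congr 1
    funext j
    rw [Pi.single_apply, ← hcoef j, map_sum]
    exact Finset.sum_congr rfl fun l _ => map_mul _ _ _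
  rw [hXi]
  exact Submodule.sum_mem _ fun l _ => Submodule.smul_mem _ _ (Submodule.subset_span ⟨l, rfl⟩)

include hx he hc hca in
/-- **Every linear form is a combination of the symbols of the generators**: for `L ∈ S_1` there is `μ ∈ k^r` with
`L = Σ_l μ_l s_l`, equivalently `coeff_{X_i} L = Σ_l μ_l ā_{li}` for all `i`. [cite: CossartJannsenSaito2020, Lemma 2.7, Def. 2.18] -/
theorem exists_coeff_eq_sum_mul_symbol {L : MvPolynomial (Fin e) (ResidueField A)}
    (hL : L ∈ homogeneousSubmodule (Fin e) (ResidueField A) 1) :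
    ∃ μ : Fin r → ResidueField A, ∀ i, MvPolynomial.coeff (Finsupp.single i 1) L = ∑ l, μ l * residue A (a l i) := by
  classical
  -- `L` lies in the span of the symbols
  have hspan : L ∈ Submodule.span (ResidueField A) (Set.range fun l => linForm fun j => residue A (a l j)) := by
    rw [eq_linForm_coeff' hL, linForm_apply]
    exact Submodule.sum_mem _ fun i _ =>
      Submodule.smul_mem _ _ (X_mem_span_symbol hx he hc a hca i)
  obtain ⟨μ, hμ⟩ := (Submodule.mem_span_range_iff_exists_fun (ResidueField A)).mp hspan
  refine ⟨μ, fun i => ?_⟩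
  rw [← hμ, MvPolynomial.coeff_sum]
  refine Finset.sum_congr rfl fun l _ => ?_
  rw [MvPolynomial.coeff_smul, coeff_single_one_linForm', smul_eq_mul]

end Symbols

/-! ## `ProjDirLiftsInto` read on combinations of the generators -/

section Lifts

variable {A : Type u} [CommRing A] [IsLocalRing A] {B : Type w} [CommRing B] [IsLocalRing B] {φ : A →+* B}
  {e : ℕ} {x : Fin e → A} (hx : Ideal.span (Set.range x) = maximalIdeal A)
  {r : ℕ} {c : Fin r → A} (a : Fin r → Fin e → A) (hca : ∀ l, c l = ∑ i, a l i * x i)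

omit [IsLocalRing A] in
include hca in
/-- `Σ_l λ_l c_l = Σ_i (Σ_l λ_l a_{li}) x_i`. [folklore] -/
private theorem sum_mul_generators_eq_sum_mul (lam : Fin r → A) :
    ∑ l, lam l * c l = ∑ i, (∑ l, lam l * a l i) * x i := by
  simp_rw [Finset.sum_mul, mul_assoc]
  rw [Finset.sum_comm]
  exact Finset.sum_congr rfl fun l _ => by rw [← Finset.mul_sum, ← hca l]

/-- The `X_i`-coefficient of the symbol `Σ_i (Σ_l λ̄_l ā_{li}) X_i` of `Σ_l λ_l c_l` is the residue of the `x_i`-coefficient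
`Σ_l λ_l a_{li}`. [folklore] -/
private theorem residue_sum_mul_eq_coeff_symbol (lam : Fin r → A) (i : Fin e) :
    residue A (∑ l, lam l * a l i) =
      MvPolynomial.coeff (Finsupp.single i 1)
        (linForm fun j => ∑ l, residue A (lam l) * residue A (a l j)) := by
  rw [coeff_single_one_linForm', map_sum]
  exact Finset.sum_congr rfl fun l _ => map_mul _ _ _

include hca in
/-- **If `ξ ∈ ℙ(Dir)` then every combination of the generators whose symbol is a directrix form goes to `(𝔪B)·𝔪_B`**:
for `ProjDirLiftsInto φ x` and `λ ∈ A^r` with `Σ_i (Σ_l λ̄_l ā_{li}) X_i ∈ 𝒯(J_x)`, `φ(Σ_l λ_l c_l) ∈ (𝔪_A B)·𝔪_B` — the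
combination is a lift of its symbol. [cite: CossartJannsenSaito2020, Def. 6.34 (i), Def. 2.18] -/
theorem ProjDirLiftsInto.map_sum_mul_mem (h : ProjDirLiftsInto φ x hx) (lam : Fin r → A)
    (hlam : (linForm fun j => ∑ l, residue A (lam l) * residue A (a l j)) ∈
      directrixSpace (tangentConeIdeal x hx)) :
    φ (∑ l, lam l * c l) ∈ (maximalIdeal A).map φ * maximalIdeal B := by
  rw [sum_mul_generators_eq_sum_mul a hca lam]
  exact h _ hlam (fun i => ∑ l, lam l * a l i) (fun i => residue_sum_mul_eq_coeff_symbol a lam i)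

variable [IsNoetherianRing A] (he : (maximalIdeal A).spanFinrank = e)
  (hc : Ideal.span (Set.range c) = maximalIdeal A)

include he hc hca in
/-- **Conversely**: let `φ : A → B` satisfy `φ(𝔪_A) ⊆ 𝔪_B`, and suppose that every coefficient vector `μ ∈ k^r` has SOME
lift `λ ∈ A^r` (`λ̄_l = μ_l`) such that `Σ_l μ_l s_l ∈ 𝒯(J_x)` implies `φ(Σ_l λ_l c_l) ∈ (𝔪_A B)·𝔪_B`. Then
`ProjDirLiftsInto φ x` («`ξ ∈ ℙ(Dir)`»): every `L ∈ 𝒯` is `Σ_l μ_l s_l` (`exists_coeff_eq_sum_mul_symbol`), the combination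
`Σ_l λ_l c_l` is a lift of `L`, and the condition does not depend on the lift (`map_lift_mem_iff_of_lifts`).
[cite: CossartJannsenSaito2020, Def. 6.34 (i), Def. 2.18] -/
theorem projDirLiftsInto_of_forall_symbol_mem (hφ : (maximalIdeal A).map φ ≤ maximalIdeal B)
    (h : ∀ μ : Fin r → ResidueField A, ∃ lam : Fin r → A, (∀ l, residue A (lam l) = μ l) ∧
      ((linForm fun j => ∑ l, μ l * residue A (a l j)) ∈ directrixSpace (tangentConeIdeal x hx) →
        φ (∑ l, lam l * c l) ∈ (maximalIdeal A).map φ * maximalIdeal B)) :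
    ProjDirLiftsInto φ x hx := by
  intro L hL d hd
  have hL1 : L ∈ homogeneousSubmodule (Fin e) (ResidueField A) 1 := directrixSpace_le_one _ hL
  obtain ⟨μ, hμ⟩ := exists_coeff_eq_sum_mul_symbol hx he hc a hca hL1
  obtain ⟨lam, hlam, hkey⟩ := h μ
  -- the symbol of `Σ λ_l c_l` is `L`
  have hsymb : (linForm fun j => ∑ l, μ l * residue A (a l j)) = L := by
    rw [eq_linForm_coeff' hL1]
    congr 1
    funext j
    rw [hμ j]
  have hmem : φ (∑ l, lam l * c l) ∈ (maximalIdeal A).map φ * maximalIdeal B := hkey (hsymb ▸ hL)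
  rw [sum_mul_generators_eq_sum_mul a hca lam] at hmem
  -- the combination is a lift of `L`; lifts are interchangeable
  have hd' : ∀ i, residue A (∑ l, lam l * a l i) = MvPolynomial.coeff (Finsupp.single i 1) L := by
    intro i
    rw [map_sum, hμ i]
    exact Finset.sum_congr rfl fun l _ => by rw [map_mul, hlam l]
  exact (map_lift_mem_iff_of_lifts hx hφ hd hd').mpr hmem

end Lifts

end Literature.RingTheory.HilbertSamuel

end
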